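import Literature.AlgebraicTopology.Homotopy.SerreFibrationInvariantCyclesDimOne
import Literature.AlgebraicTopology.SingularHomology.MayerVietorisExactness
import Literature.AlgebraicTopology.SingularHomology.ClopenAdditivity
import HarnessLib

/-!
# A fibrewise endomorphism acting as a scalar on the fibres acts as that scalar on the middle Leray piece
# (Serre fibrations over bases of dimension `≤ 1`)

Topic `Literature/AlgebraicTopology/Homotopy`. PROOF FILE (theorems only; no definition, no named fact).
Companion of `SerreFibrationInvariantCyclesDimOne`. Let `p : E → B` be a Serre fibration, `K` a field and
`ν : E → E` a map OVER `B` (`p ∘ ν = p`). The Leray spectral sequence is natural in such maps, and over a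
base of the (weak) homotopy type of a `1`-dimensional CW complex it has the two columns `E₂^{0,q}`,
`E₂^{1,q} = H¹(B; Rᵠ p_* K)`; so if `ν` acts on `Hᵠ(p⁻¹b; K)` of EVERY fibre as the scalar `c`, it acts as
`c` on the coefficient system `Rᵠ p_* K`, hence on `H¹(B; Rᵠ p_* K) = L¹H^{q+1}(E; K) = ker (H^{q+1}(E) →
∏_b H^{q+1}(p⁻¹b))` (Voisin II §4.2.3, Thm. 4.15 setting; Hatcher §3.1 naturality of Mayer–Vietoris). We
prove this WITHOUT the spectral sequence, in the homological form and then dualised: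

* `SerreFibrewiseScalar.sub_smul_mem_cw_of_cells_le_one` — over a Hausdorff CW complex WITHOUT CELLS OF
  DIMENSION `> 1`: for every `α ∈ H_{q+1}(E; K)`, `ν_* α - c·α` is a (finite) sum of classes of fibres
  (Mayer–Vietoris for the cover of `E` by `p⁻¹` of the open collar of `X⁰` and of the small open `1`-cells:
  `∂(ν_*α - cα) = (ν_* - c)∂α = 0` because `∂α` lives on `p⁻¹` of a disjoint union of contractible arcs,
  whose homology comes from fibres; and the kernel of `∂` is the image of `H(p⁻¹ collar) ⊕ H(p⁻¹ cells)`,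
  which again comes from fibres — `X⁰ ↪ collar` is a deformation retract, Spanier 9.2.17);
* the transfer to bases weakly equivalent to such complexes, to exhausted bases (the complex points of a smooth
  affine curve), and the **cohomological form** — a class `z ∈ H^{q+1}(E; K)` vanishing on every fibre satisfies
  `ν^* z = c·z` as soon as `ν^*` acts as `c` on `Hᵠ` of every fibre — are in the sequel
  `SerreFibrationFibrewiseScalarExhaustion`.

Consumer: the Leray weights of the multiplication `θ_N` of an abelian scheme over a punctured curve (Hodge summit,
Ring 2, André axis part XXV: the clause (roots) of `Ring2AbelianAllAndreWeightRoots`).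

## References

* C. Voisin, *Hodge Theory and Complex Algebraic Geometry II*, CUP (2003), §4.2.3, Thm. 4.15, §4.3.1 Thm. 4.18.
  [VoisinHodgeII2003]
* A. Hatcher, *Algebraic Topology*, CUP (2002), §2.2 pp. 149–150 (Mayer–Vietoris, naturality), Prop. 2.6,
  §3.1 Thm. 3.2 (p. 198), Prop. 3.33. [HatcherAT2002]
* E. H. Spanier, *Algebraic Topology*, Springer (1981), Ch. 9 Sec. 2 Thm. 17. [Spanier1981]
-/

noncomputable section

open Set Function Metric CategoryTheory
open scoped Topology unitInterval
open Literature.AlgebraicTopology.SingularHomology Literature.Algebra.Homology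

namespace Literature.AlgebraicTopology.Homotopy

universe u

namespace SerreFibrewiseScalar

open _root_.Topology RelCWComplex SkeletonCollar CellsDirectSum SerreFlat SerreInvariantCycles

/-! ### Generalities: homology of relatively open partitions and of contractible pieces -/

section Generalities

variable (K : Type u) [Field K]
variable {M : Type u} [TopologicalSpace M]

/-- **Every class of `Hₙ(↥O)` is a finite sum of classes of the pieces of a relatively open partition of `O`**
(additivity of singular homology over disjoint open pieces, Hatcher Prop. 2.6, transported to pieces given as
subsets of the ambient space). [cite: HatcherAT2002, Prop. 2.6] -/
theorem exists_eq_sum_of_pieces {ι : Type u} {O : Set M} {P : ι → Set M} (hPO : ∀ i, P i ⊆ O)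
    (hP : ∀ i, ∃ W : Set M, IsOpen W ∧ P i = O ∩ W) (hdisj : ∀ i j, i ≠ j → Disjoint (P i) (P j))
    (hcov : O ⊆ ⋃ i, P i) (n : ℕ) (γ : singularHomology K K ↥O n) :
    ∃ (S : Finset ι) (c : ∀ i, singularHomology K K ↥(P i) n),
      γ = ∑ i ∈ S, singularHomology.map K K (subsetInclusion (hPO i)) n (c i) := by
  have hpart := isClopenPartition_preimage hP hdisj hcov
  obtain ⟨S, x, hx⟩ := singularHomology.exists_eq_sum_map_subsetIncl hpart n γ
  let e : ∀ i, ↥(Subtype.val ⁻¹' P i : Set ↥O) ≃ₜ ↥(P i) := fun i => preimageValHomeomorphOfSubset (hPO i)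
  refine ⟨S, fun i => singularHomology.map K K (e i : C(_, ↥(P i))) n (x i), ?_⟩
  rw [hx]
  refine Finset.sum_congr rfl fun i _ => ?_
  have hf : subsetIncl (Subtype.val ⁻¹' P i : Set ↥O) = (subsetInclusion (hPO i)).comp (e i : C(_, ↥(P i))) :=
    ContinuousMap.ext fun _ => rfl
  rw [hf, singularHomology.map_comp, ModuleCat.comp_apply]

/-- Transport of "`ν_*` is the scalar `c` on `Hₙ`" along a homeomorphism intertwining two self-maps (a homeomorphism
induces isomorphisms on singular homology, functorially). [cite: HatcherAT2002, §2.1 Cor. 2.11 and p. 111 (functoriality)] -/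
theorem map_eq_smul_of_homeomorph {F F' : Type u} [TopologicalSpace F] [TopologicalSpace F'] (φ : F' ≃ₜ F)
    (ν' : C(F', F')) (νF : C(F, F)) (hφ : ∀ e, φ (ν' e) = νF (φ e)) {n : ℕ} {c : K}
    (h : ∀ y : singularHomology K K F n, singularHomology.map K K νF n y = c • y) (y' : singularHomology K K F' n) :
    singularHomology.map K K ν' n y' = c • y' := by
  haveI := isIso_singularHomology_map_of_isWeakHomotopyEquiv K _ (IsWeakHomotopyEquiv.of_homeomorph φ) n
  have hinj := (bijective_hom_of_isIso (singularHomology.map K K (φ : C(F', F)) n)).1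
  apply hinj
  have hfac : (φ : C(F', F)).comp ν' = νF.comp (φ : C(F', F)) := ContinuousMap.ext hφ
  change singularHomology.map K K (φ : C(F', F)) n (singularHomology.map K K ν' n y') =
    singularHomology.map K K (φ : C(F', F)) n (c • y')
  rw [map_smul, ← ModuleCat.comp_apply, ← singularHomology.map_comp, hfac, singularHomology.map_comp,
    ModuleCat.comp_apply, h]

variable {E : Type u} {B : Type u} [TopologicalSpace E] [TopologicalSpace B] {p : E → B}

/-- **Over a contractible `T ∋ b`, every class of `Hₙ(p⁻¹T)` comes from the fibre `p⁻¹b`** (`p⁻¹b ↪ p⁻¹T` is a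
weak equivalence, Spanier 9.2.17). [cite: Spanier1981, Ch. 9, Sec. 2, Thm. 17] -/
theorem surjective_map_fibre_of_contractible (hp : IsSerreFibration p) {T : Set B} [ContractibleSpace ↥T] {b : B}
    (hb : b ∈ T) (n : ℕ) :
    Surjective (singularHomology.map K K (subsetInclusion (fibre_subset_preimage hb : p ⁻¹' {b} ⊆ p ⁻¹' T)) n) := by
  have hST : ({b} : Set B) ⊆ T := singleton_subset_iff.2 hb
  have hw := hp.isWeakHomotopyEquiv_preimage_inclusion hST
    (SerreCube.isWeakHomotopyEquiv_subsetInclusion_of_contractible hST)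
  haveI := isIso_singularHomology_map_of_isWeakHomotopyEquiv K _ hw n
  exact (bijective_hom_of_isIso (singularHomology.map K K
    (subsetInclusion (preimage_mono hST : p ⁻¹' {b} ⊆ p ⁻¹' T)) n)).2

/-- **A map over `B` acting as `c` on `Hₙ` of the fibre `p⁻¹b` acts as `c` on `Hₙ(p⁻¹T)` for contractible `T ∋ b`.**
[cite: Spanier1981, Ch. 9, Sec. 2, Thm. 17] -/
theorem map_eq_smul_of_contractible (hp : IsSerreFibration p) (ν : C(E, E)) (hν : ∀ e, p (ν e) = p e) {n : ℕ}
    {c : K}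
    (hνF : ∀ (b : B) (νb : C(↥(p ⁻¹' {b}), ↥(p ⁻¹' {b}))), (∀ e, (νb e : E) = ν e) →
      ∀ x : singularHomology K K ↥(p ⁻¹' {b}) n, singularHomology.map K K νb n x = c • x)
    {T : Set B} [ContractibleSpace ↥T] {b : B} (hb : b ∈ T) (νT : C(↥(p ⁻¹' T), ↥(p ⁻¹' T)))
    (hνT : ∀ e, (νT e : E) = ν e) (x : singularHomology K K ↥(p ⁻¹' T) n) :
    singularHomology.map K K νT n x = c • x := by
  have hmem : ∀ e : ↥(p ⁻¹' {b}), ν e ∈ p ⁻¹' ({b} : Set B) := fun e => by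
    show p (ν e.1) ∈ ({b} : Set B); rw [hν]; exact e.2
  let νb : C(↥(p ⁻¹' {b}), ↥(p ⁻¹' {b})) :=
    ⟨fun e => ⟨ν e, hmem e⟩, (ν.continuous.comp continuous_subtype_val).subtype_mk hmem⟩
  obtain ⟨y, rfl⟩ := surjective_map_fibre_of_contractible K hp hb n x
  have hfac : νT.comp (subsetInclusion (fibre_subset_preimage hb : p ⁻¹' {b} ⊆ p ⁻¹' T)) =
      (subsetInclusion (fibre_subset_preimage hb : p ⁻¹' {b} ⊆ p ⁻¹' T)).comp νb :=
    ContinuousMap.ext fun e => Subtype.ext (hνT _)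
  rw [← ModuleCat.comp_apply, ← singularHomology.map_comp, hfac, singularHomology.map_comp, ModuleCat.comp_apply,
    hνF b νb (fun _ => rfl) y, map_smul]

end Generalities

/-! ### Over a CW complex without cells of dimension `> 1` -/

section CWBase

variable (K : Type u) [Field K]
variable {X : Type u} [TopologicalSpace X] [T2Space X] [CWComplex (univ : Set X)]
variable {E : Type u} [TopologicalSpace E] {p : E → X} (hp : IsSerreFibration p)
  (ν : C(E, E)) (hν : ∀ e, p (ν e) = p e) {n : ℕ} {c : K}
  (hνF : ∀ (x : X) (νx : C(↥(p ⁻¹' {x}), ↥(p ⁻¹' {x}))), (∀ e, (νx e : E) = ν e) →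
    ∀ y : singularHomology K K ↥(p ⁻¹' {x}) n, singularHomology.map K K νx n y = c • y)

include hp hν hνF in
/-- **Over a Hausdorff CW complex without cells of dimension `> 1`, a map over the base acting as `c` on `Hₙ` of
every fibre acts as `c` on `H_{n+1}(E)` modulo classes of fibres**: `ν_* α - c·α ∈ Σ_x im(H_{n+1}(p⁻¹x) → H_{n+1}(E))`.
Mayer–Vietoris for the cover of `E = p⁻¹X¹` by `p⁻¹` of the open collar `D` of `X⁰` and of the small open `1`-cells:
the connecting map is natural in `ν` and lands in `Hₙ(p⁻¹(D ∩ cells))`, a sum over contractible arcs, where `ν_*` is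
`c`; so `∂(ν_*α - cα) = 0` and `ν_*α - cα` comes from `H(p⁻¹D) ⊕ H(p⁻¹ cells)`, i.e. from fibres (`X⁰ ↪ D` is a strong
deformation retract; the cells are contractible; Spanier 9.2.17). [cite: HatcherAT2002, §2.2 pp. 149–150 and Prop. 2.6]
[cite: Spanier1981, Ch. 9, Sec. 2, Thm. 17] [cite: VoisinHodgeII2003, §4.2.3 and §4.3.1] -/
theorem sub_smul_mem_cw_of_cells_le_one (h1 : ∀ m, 1 < m → IsEmpty (cell (univ : Set X) m))
    (α : singularHomology K K E (n + 1)) :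
    singularHomology.map K K ν (n + 1) α - c • α ∈
      ⨆ x : X, LinearMap.range (singularHomology.map K K (subsetIncl (p ⁻¹' {x})) (n + 1)).hom := by
  classical
  -- notation
  set X0 : Set X := (skeletonLT (univ : Set X) ((1 : ℕ) : ℕ∞) : Set X) with hX0
  set X1 : Set X := (skeletonLT (univ : Set X) (((1 : ℕ) : ℕ∞) + 1) : Set X) with hX1
  set D : Set X := X1 \ ⋃ j : cell (univ : Set X) 1, map 1 j '' closedBall (0 : Fin 1 → ℝ) 2⁻¹ with hD
  let Bj : cell (univ : Set X) 1 → Set X := fun j => map 1 j '' ball (0 : Fin 1 → ℝ) (3 / 4)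
  set Bs : Set X := ⋃ j, Bj j with hBs
  have hX1u : X1 = univ := skel_one_eq_univ h1
  have hX0D : X0 ⊆ D := skeletonLT_subset_diff_iUnion
  have hb34 : ball (0 : Fin 1 → ℝ) (3 / 4) ⊆ ball 0 1 := ball_subset_ball (by norm_num)
  have hBjBs : ∀ j, Bj j ⊆ Bs := fun j => subset_iUnion Bj j
  -- restrictions of `ν` over subsets of the base
  have hres : ∀ C : Set X, ∃ νC : C(↥(p ⁻¹' C), ↥(p ⁻¹' C)), ∀ e, (νC e : E) = ν e := fun C => by
    have hmem : ∀ e : ↥(p ⁻¹' C), ν e ∈ p ⁻¹' C := fun e => by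
      show p (ν e.1) ∈ C; rw [hν]; exact e.2
    exact ⟨⟨fun e => ⟨ν e, hmem e⟩, (ν.continuous.comp continuous_subtype_val).subtype_mk hmem⟩, fun _ => rfl⟩
  choose νr hνr using hres
  -- the target submodule
  set R : Submodule K (singularHomology K K E (n + 1)) :=
    ⨆ x : X, LinearMap.range (singularHomology.map K K (subsetIncl (p ⁻¹' {x})) (n + 1)).hom with hR
  have hRmem : ∀ (x : X) (y : singularHomology K K ↥(p ⁻¹' {x}) (n + 1)),
      singularHomology.map K K (subsetIncl (p ⁻¹' {x})) (n + 1) y ∈ R := fun x y =>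
    (Submodule.mem_iSup_of_mem x (LinearMap.mem_range_self _ y) :
      (singularHomology.map K K (subsetIncl (p ⁻¹' {x})) (n + 1)).hom y ∈ R)
  -- (1) the open cover `E = p⁻¹D ∪ p⁻¹Bs`
  have hDo : IsOpen D := by
    have h : D = (⋃ j : cell (univ : Set X) 1, map 1 j '' closedBall (0 : Fin 1 → ℝ) 2⁻¹)ᶜ := by
      rw [hD, hX1u, Set.sdiff_eq, Set.univ_inter]
    rw [h]
    exact isClosed_iUnion_image_closedBall_half.isOpen_compl
  have hBjo : ∀ j, IsOpen (Bj j) := fun j => by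
    obtain ⟨W, hWo, hW⟩ := exists_isOpen_inter_eq_image j isOpen_ball hb34
    have h : Bj j = W := by
      change map 1 j '' ball (0 : Fin 1 → ℝ) (3 / 4) = W
      rw [← hW, ← hX1, hX1u, univ_inter]
    rw [h]; exact hWo
  have hBso : IsOpen Bs := isOpen_iUnion hBjo
  set U : Set E := p ⁻¹' D with hU
  set V : Set E := p ⁻¹' Bs with hV
  have hUo : IsOpen U := hDo.preimage hp.continuous
  have hVo : IsOpen V := hBso.preimage hp.continuous
  have hcovX : ∀ x : X, x ∈ D ∨ x ∈ Bs := fun x => by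
    have hx1 : x ∈ X1 := by rw [hX1u]; exact mem_univ x
    rcases mem_skeletonLT_succ_iff.1 hx1 with h | ⟨j, y₁, hy₁, hje⟩
    · exact Or.inl (hX0D h)
    · by_cases h34 : ‖y₁‖ < 3 / 4
      · exact Or.inr (mem_iUnion.2 ⟨j, y₁, mem_ball_zero_iff.2 h34, hje.symm⟩)
      · left
        rw [hje]
        exact map_mem_D j (lt_of_lt_of_le (by norm_num) (not_lt.1 h34)) (mem_ball_zero_iff.1 hy₁).le
  have hUV : interior U ∪ interior V = univ := by
    rw [hUo.interior_eq, hVo.interior_eq]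
    exact eq_univ_of_forall fun e => (hcovX (p e)).imp id id
  have hνU : MapsTo ν U U := fun e he => by show p (ν e) ∈ D; rw [hν]; exact he
  have hνV : MapsTo ν V V := fun e he => by show p (ν e) ∈ Bs; rw [hν]; exact he
  have hexc := relativeSingularHomology.isIso_map_of_interior_union_interior_holds K K E
  -- (2) `ν_*` acts as `c` on `Hₙ(p⁻¹(D ∩ Bs))`: the pieces are `p⁻¹` of contractible arcs
  have hC1 : ∀ γ : singularHomology K K ↥(U ∩ V) n,
      singularHomology.map K K (subsetRestrict ν (hνU.inter_inter hνV)) n γ = c • γ := by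
    -- the arcs `Φⱼ(½ < ±y 0 < ¾)`
    let sg : Bool → ℝ := fun b => if b then 1 else -1
    let Sarc : Bool → Set (Fin 1 → ℝ) := fun b => (fun y : Fin 1 → ℝ => sg b * y 0) ⁻¹' Ioo 2⁻¹ (3 / 4)
    have hSnorm : ∀ b, ∀ y ∈ Sarc b, ‖y‖ = sg b * y 0 := fun b y hy => by
      rw [norm_fin_one]
      have h : 0 < sg b * y 0 := lt_trans (by norm_num) hy.1
      cases b
      · simp only [sg, Bool.false_eq_true, ↓reduceIte, neg_mul, one_mul] at h ⊢
        exact abs_of_neg (by linarith)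
      · simp only [sg, ↓reduceIte, one_mul] at h ⊢
        exact abs_of_pos h
    have hSball : ∀ b, Sarc b ⊆ ball 0 1 := fun b y hy => by
      rw [mem_ball_zero_iff, hSnorm b y hy]; linarith [hy.2]
    have hSopen : ∀ b, IsOpen (Sarc b) := fun b =>
      isOpen_Ioo.preimage (continuous_const.mul (continuous_apply 0))
    have hSconv : ∀ b, Convex ℝ (Sarc b) := fun b =>
      (convex_Ioo (2⁻¹ : ℝ) (3 / 4)).is_linear_preimage
        ⟨fun y₁ y₂ => by simp only [Pi.add_apply, mul_add], fun c y₁ => by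
          simp only [Pi.smul_apply, smul_eq_mul]; ring⟩
    have hSr : ∀ b, Sarc b ⊆ closedBall 0 (3 / 4) := fun b y hy =>
      ball_subset_closedBall (by rw [mem_ball_zero_iff, hSnorm b y hy]; exact hy.2)
    have hmid : ∀ b, (fun _ => sg b * (5 / 8) : Fin 1 → ℝ) ∈ Sarc b := fun b => by
      have h2 : sg b * sg b = 1 := by cases b <;> simp [sg]
      constructor <;> nlinarith [h2]
    let P : cell (univ : Set X) 1 × Bool → Set X := fun q => map 1 q.1 '' Sarc q.2
    have hPD : ∀ q, P q ⊆ D := fun q => by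
      rintro _ ⟨y₁, hy₁, rfl⟩
      have hn := hSnorm q.2 y₁ hy₁
      exact map_mem_D q.1 (by rw [hn]; exact hy₁.1) (by rw [hn]; linarith [hy₁.2])
    have hPBs : ∀ q, P q ⊆ Bs := fun q =>
      (image_mono fun y₁ hy₁ => by rw [mem_ball_zero_iff, hSnorm q.2 y₁ hy₁]; exact hy₁.2).trans (hBjBs q.1)
    have hPO : ∀ q, p ⁻¹' P q ⊆ U ∩ V := fun q => subset_inter (preimage_mono (hPD q)) (preimage_mono (hPBs q))
    have hPopen : ∀ q, ∃ W : Set E, IsOpen W ∧ p ⁻¹' P q = (U ∩ V) ∩ W := fun q => by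
      obtain ⟨W, hWo, hW⟩ := exists_isOpen_inter_eq_image q.1 (hSopen q.2) (hSball q.2)
      have h : P q = W := by
        change map 1 q.1 '' Sarc q.2 = W
        rw [← hW, ← hX1, hX1u, univ_inter]
      refine ⟨p ⁻¹' W, hWo.preimage hp.continuous, ?_⟩
      rw [inter_eq_right.2 ((preimage_mono h.symm.subset).trans (hPO q)), h]
    have hPdisj : ∀ q q', q ≠ q' → Disjoint (p ⁻¹' P q) (p ⁻¹' P q') := by
      rintro ⟨j, b⟩ ⟨j', b'⟩ hne
      refine Disjoint.preimage p ?_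
      by_cases hj : j = j'
      · subst hj
        have hb : b ≠ b' := fun h => hne (by rw [h])
        refine Set.disjoint_left.2 ?_
        rintro _ ⟨y₁, hy₁, rfl⟩ ⟨y₂, hy₂, h⟩
        have heq : y₂ = y₁ := map_injOn j (hSball b' hy₂) (hSball b hy₁) h
        subst heq
        have h1 := hy₁.1; have h2 := hy₂.1
        cases b <;> cases b' <;> simp [sg] at hb h1 h2 <;> linarith
      · exact disjoint_image_of_ne hj (hSball b) (hSball b')
    have hPcov : U ∩ V ⊆ ⋃ q, p ⁻¹' P q := by
      rintro e ⟨heD, heB⟩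
      obtain ⟨j, y₁, hy₁, hje⟩ : ∃ j y₁, y₁ ∈ ball (0 : Fin 1 → ℝ) (3 / 4) ∧ map 1 j y₁ = p e := by
        obtain ⟨j, hj⟩ := mem_iUnion.1 heB
        obtain ⟨y₁, hy₁, h⟩ := hj
        exact ⟨j, y₁, hy₁, h⟩
      have hhalf : 2⁻¹ < ‖y₁‖ := by
        by_contra hle
        exact heD.2 (mem_iUnion.2 ⟨j, y₁, mem_closedBall_zero_iff.2 (not_lt.1 hle), hje⟩)
      let b : Bool := decide (0 ≤ y₁ 0)
      have hsg' : sg b * y₁ 0 = ‖y₁‖ := by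
        rw [norm_fin_one]
        by_cases h : 0 ≤ y₁ 0
        · simp [sg, b, h, abs_of_nonneg h]
        · simp [sg, b, h, abs_of_neg (not_le.1 h)]
      refine mem_iUnion.2 ⟨(j, b), ?_⟩
      show p e ∈ map 1 j '' Sarc b
      exact ⟨y₁, ⟨(show 2⁻¹ < sg b * y₁ 0 by rw [hsg']; exact hhalf),
        (show sg b * y₁ 0 < 3 / 4 by rw [hsg']; exact mem_ball_zero_iff.1 hy₁)⟩, hje⟩
    -- decompose `γ` over the pieces and use the fibre hypothesis on each contractible arc
    intro γ
    obtain ⟨S, cq, hγ⟩ := exists_eq_sum_of_pieces K hPO hPopen hPdisj hPcov n γ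
    have hterm : ∀ q, singularHomology.map K K (subsetRestrict ν (hνU.inter_inter hνV)) n
        (singularHomology.map K K (subsetInclusion (hPO q)) n (cq q)) =
        c • singularHomology.map K K (subsetInclusion (hPO q)) n (cq q) := by
      intro q
      haveI : ContractibleSpace ↥(P q) :=
        contractibleSpace_image q.1 (hSconv q.2) ⟨_, hmid q.2⟩ (by norm_num) (hSr q.2)
      have hb₀ : map 1 q.1 (fun _ => sg q.2 * (5 / 8)) ∈ P q := ⟨_, hmid q.2, rfl⟩
      have hfac : (subsetRestrict ν (hνU.inter_inter hνV)).comp (subsetInclusion (hPO q)) =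
          (subsetInclusion (hPO q)).comp (νr (P q)) :=
        ContinuousMap.ext fun e => Subtype.ext (by rw [ContinuousMap.comp_apply, ContinuousMap.comp_apply]; exact (hνr (P q) e).symm)
      rw [← ModuleCat.comp_apply, ← singularHomology.map_comp, hfac, singularHomology.map_comp, ModuleCat.comp_apply,
        map_eq_smul_of_contractible K hp ν hν hνF hb₀ (νr (P q)) (hνr (P q)) (cq q), map_smul]
    rw [hγ, map_sum, Finset.smul_sum]
    exact Finset.sum_congr rfl fun q _ => hterm q
  -- (3) `∂(ν_*α - cα) = 0`
  set β := singularHomology.map K K ν (n + 1) α - c • α with hβ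
  have hδβ : mayerVietoris.δ K K U V hexc hUV n β = 0 := by
    have hnat := mayerVietoris.δ_naturality_holds K K (X := E) (Y := E) hexc hexc ν hνU hνV hUV hUV n
    have hnatα := congrArg (fun φ => φ α) hnat
    simp only [ModuleCat.comp_apply] at hnatα
    rw [hβ, map_sub, map_smul, ← hnatα, hC1, sub_self]
  -- (4) exactness at `H_{n+1}(E)`: `β` comes from `H_{n+1}(p⁻¹D) ⊞ H_{n+1}(p⁻¹Bs)`
  have hex := mayerVietoris.exact₂_holds K K U V hexc hUV n
  obtain ⟨yy, hyy⟩ := (ShortComplex.moduleCat_exact_iff _).1 hex β hδβ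
  change mayerVietoris.ψ K K U V (n + 1) yy = β at hyy
  rw [mayerVietoris.ψ, biprod_desc_apply] at hyy
  rw [← hyy]
  refine Submodule.add_mem _ ?_ ?_
  · -- (5) classes of `p⁻¹D` come from `p⁻¹X⁰`, a disjoint union of fibres
    obtain ⟨eH, heH⟩ := (isStrongDeformationRetractOf_D (X := X) (s := 1)).exists_homotopyEquiv_inclusion hX0D
    have hw : IsWeakHomotopyEquiv (subsetInclusion hX0D) := by
      have h := isWeakHomotopyEquiv_homotopyEquiv eH
      rw [heH] at h
      exact h
    have hwE := hp.isWeakHomotopyEquiv_preimage_inclusion hX0D hw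
    haveI := isIso_singularHomology_map_of_isWeakHomotopyEquiv K _ hwE (n + 1)
    obtain ⟨y₀, hy₀⟩ := (bijective_hom_of_isIso (singularHomology.map K K
      (subsetInclusion (preimage_mono hX0D : p ⁻¹' X0 ⊆ p ⁻¹' D)) (n + 1))).2
      ((Limits.biprod.fst : singularHomology K K ↥U (n + 1) ⊞ singularHomology K K ↥V (n + 1) ⟶ _) yy)
    -- the fibres over the `0`-cells partition `p⁻¹X⁰`
    have hX0e : (skeletonLT (univ : Set X) (((0 : ℕ) : ℕ∞) + 1) : Set X) = X0 := by
      rw [hX0]; norm_num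
    have hX0pieces : ∀ v : ↥X0, ∃ W : Set X, IsOpen W ∧ ({(v : X)} : Set X) = X0 ∩ W := by
      intro v
      have hv : (v : X) ∈ (skeletonLT (univ : Set X) (((0 : ℕ) : ℕ∞) + 1) : Set X) := by
        rw [hX0e]; exact v.2
      rcases mem_skeletonLT_succ_iff.1 hv with h | ⟨j, y₀', hy₀', hvj⟩
      · simp [RelCWComplex.skeletonLT_zero_eq_base] at h
      · obtain ⟨W, hWo, hW⟩ := exists_isOpen_inter_eq_image j isOpen_ball (subset_refl (ball (0 : Fin 0 → ℝ) 1))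
        refine ⟨W, hWo, ?_⟩
        have hXW : X0 ∩ W = (skeletonLT (univ : Set X) (((0 : ℕ) : ℕ∞) + 1) : Set X) ∩ W := by rw [hX0e]
        rw [hXW, hW, hvj]
        ext x
        simp only [mem_singleton_iff, mem_image]
        constructor
        · rintro rfl; exact ⟨y₀', hy₀', rfl⟩
        · rintro ⟨y', -, rfl⟩; rw [Subsingleton.elim y' y₀']
    have hQO : ∀ v : ↥X0, p ⁻¹' {(v : X)} ⊆ p ⁻¹' X0 := fun v => fibre_subset_preimage v.2
    have hQopen : ∀ v : ↥X0, ∃ W : Set E, IsOpen W ∧ p ⁻¹' {(v : X)} = p ⁻¹' X0 ∩ W := fun v => by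
      obtain ⟨W, hWo, hW⟩ := hX0pieces v
      exact ⟨p ⁻¹' W, hWo.preimage hp.continuous, by rw [← preimage_inter, ← hW]⟩
    have hQdisj : ∀ v v' : ↥X0, v ≠ v' → Disjoint (p ⁻¹' {(v : X)}) (p ⁻¹' {(v' : X)}) :=
      fun v v' hne => Disjoint.preimage p (disjoint_singleton.2 fun h => hne (Subtype.ext h))
    have hQcov : p ⁻¹' X0 ⊆ ⋃ v : ↥X0, p ⁻¹' {(v : X)} := fun e he => mem_iUnion.2 ⟨⟨p e, he⟩, rfl⟩
    obtain ⟨S₀, c₀, hc₀⟩ := exists_eq_sum_of_pieces K hQO hQopen hQdisj hQcov (n + 1) y₀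
    rw [← hy₀, hc₀, map_sum, map_sum]
    refine Submodule.sum_mem _ fun v _ => ?_
    have hfac : ((subsetIncl U).comp (subsetInclusion (preimage_mono hX0D : p ⁻¹' X0 ⊆ p ⁻¹' D))).comp
        (subsetInclusion (hQO v)) = subsetIncl (p ⁻¹' {(v : X)}) := ContinuousMap.ext fun _ => rfl
    change (singularHomology.map K K (subsetIncl U) (n + 1)) ((singularHomology.map K K
      (subsetInclusion (preimage_mono hX0D : p ⁻¹' X0 ⊆ p ⁻¹' D)) (n + 1)) _) ∈ R
    rw [← ModuleCat.comp_apply, ← ModuleCat.comp_apply, ← singularHomology.map_comp, ← singularHomology.map_comp, hfac]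
    exact hRmem _ _
  · -- (6) classes of `p⁻¹Bs` come from the fibres over the centres of the cells
    have hBO : ∀ j, p ⁻¹' Bj j ⊆ V := fun j => preimage_mono (hBjBs j)
    have hBopen : ∀ j, ∃ W : Set E, IsOpen W ∧ p ⁻¹' Bj j = V ∩ W := fun j =>
      ⟨p ⁻¹' Bj j, (hBjo j).preimage hp.continuous, (inter_eq_right.2 (hBO j)).symm⟩
    have hBdisj : ∀ j j', j ≠ j' → Disjoint (p ⁻¹' Bj j) (p ⁻¹' Bj j') := fun j j' hne =>
      (disjoint_image_of_ne hne hb34 hb34).preimage p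
    have hBcov : V ⊆ ⋃ j, p ⁻¹' Bj j := fun e he => by
      obtain ⟨j, hj⟩ := mem_iUnion.1 he; exact mem_iUnion.2 ⟨j, hj⟩
    obtain ⟨S₂, c₂, hc₂⟩ := exists_eq_sum_of_pieces K hBO hBopen hBdisj hBcov (n + 1)
      ((Limits.biprod.snd : singularHomology K K ↥U (n + 1) ⊞ singularHomology K K ↥V (n + 1) ⟶ _) yy)
    rw [hc₂, map_sum]
    refine Submodule.sum_mem _ fun j _ => ?_
    have hsub : ball (0 : Fin 1 → ℝ) (3 / 4) ⊆ closedBall 0 (7 / 8) :=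
      ball_subset_closedBall.trans (closedBall_subset_closedBall (by norm_num))
    haveI : ContractibleSpace ↥(Bj j) :=
      contractibleSpace_image j (convex_ball 0 _) ⟨0, mem_ball_self (by norm_num)⟩ (by norm_num) hsub
    have hcen : map 1 j 0 ∈ Bj j := ⟨0, mem_ball_self (by norm_num), rfl⟩
    obtain ⟨c', hc'⟩ := surjective_map_fibre_of_contractible K hp hcen (n + 1) (c₂ j)
    rw [← hc']
    have hfac : ((subsetIncl V).comp (subsetInclusion (hBO j))).comp
        (subsetInclusion (fibre_subset_preimage hcen : p ⁻¹' {map 1 j 0} ⊆ p ⁻¹' Bj j)) =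
        subsetIncl (p ⁻¹' {map 1 j 0}) := ContinuousMap.ext fun _ => rfl
    change (singularHomology.map K K (subsetIncl V) (n + 1)) ((singularHomology.map K K (subsetInclusion (hBO j)) (n + 1)) _) ∈ R
    rw [← ModuleCat.comp_apply, ← ModuleCat.comp_apply, ← singularHomology.map_comp, ← singularHomology.map_comp, hfac]
    exact hRmem _ _

end CWBase

end SerreFibrewiseScalar

end Literature.AlgebraicTopology.Homotopy

end
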